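import Literature.MathematicalPhysics.QuantumLattice.HubbardUniformDensityGibbs
import Literature.MathematicalPhysics.QuantumLattice.HartreeFockUpperBound
import HarnessLib

/-!
# No correlations within a sublattice for free electrons at half filling (Lieb–Loss–McCann, Remark I)

Lieb, Loss and McCann, *Uniform density theorem for the Hubbard model*, J. Math. Phys. **34**
(1993) 891, consequence **I. No Correlations within a Sublattice for the Free Electron Model**
(arXiv:cond-mat/9304015, pp. 4–5 of the held text): for the free electron model
(`U = 0`) the grand-canonical Gibbs state at zero chemical potential is quasi-free, so Wick's
theorem expresses every reduced density matrix through the one-body matrix,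
`ρ^{(n)}_{βσ}({xᵢ; yᵢ}) = det [ρ^{(1)}_{βσ}(xᵢ, yⱼ)]`, and the uniform density theorem
(`ρ_{βσ}(x, y) = ½ δ_{xy}` on a sublattice) gives, for all `x₁, …, xₙ, y₁, …, yₙ` in the same
sublattice,

  `ρ^{(n)}_{βσ}(x₁, …, xₙ; y₁, …, yₙ) = 2^{-n} det [δ_{xᵢ yⱼ}]`

— "there can be no spatial correlations in the electron density between sites of the same
sublattice, save only that the probability of finding more than one electron in the same site and
spin state vanishes"; in particular the pair density is `ρ^{(2)}_{βσ}(x, y; x, y) = (1 - δ_{xy})/4`,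
"the product of the one-particle densities at `x ≠ y`. Thus the Pauli pressure is not felt between
the electrons at these sites." The spin-dependent form (LLM eq. (8) remark) takes all `(xᵢ, σᵢ)`,
`(yᵢ, τᵢ)` in the same sublattice: `ρ^{(n)} = 2^{-n} det [δ_{xᵢyⱼ} δ_{σᵢτⱼ}]`.

This file PROVES these statements for the tree's Hubbard Hamiltonian at `U = 0`, `μ = 0`
(`hamiltonianWith G t 0 0 = dΓ(hubbardOneBody G t 0)`, `hamiltonianWith_zero_eq_dGamma`) on any
finite graph with a bipartite sign `ε` (`ε x = -ε y` across edges), every real `t` and `β`, by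
combining two tree theorems: the thermal Wick theorem / determinant formula for quasi-free Gibbs
states (`gibbsState_dGamma_nestedWord`, `HartreeFock.gibbsState_numberAt_mul_numberAt`; Gaudin
1960) and the uniform density theorem at positive temperature
(`hubbard_gibbsState_creation_mul_annihilation_halfFilling`, file `HubbardUniformDensityGibbs`):

* `hubbard_free_gibbsState_nestedWord_sameSublattice` — the `n`-point formula
  `⟨c†_{x₁σ₁} ⋯ c†_{xₙσₙ} c_{yₙτₙ} ⋯ c_{y₁τ₁}⟩_β = (1/2)^n det [δ_{(xᵢ,σᵢ),(yⱼ,τⱼ)}]` whenever all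
  `ε xᵢ = ε yⱼ`;
* `hubbard_free_gibbsState_numberOp_mul_numberOp_sameSublattice` — the pair density
  `⟨n_{xσ} n_{yτ}⟩_β = 1/4` for distinct spin-orbitals `(x, σ) ≠ (y, τ)` with `ε x = ε y`, and
  `hubbard_free_gibbsState_numberOp_mul_numberOp_eq_mul` — `= ⟨n_{xσ}⟩_β ⟨n_{yτ}⟩_β` (no density
  correlation within a sublattice).

Everything is PROVED; no definition, no named fact. Honest scope: finite graphs, the grand-canonical
state at `μ = 0` only (LLM stress that the statement fails for the canonical ensemble and for
`U ≠ 0`, Remark I, second half); LLM's general bipartite `T` of (3)/(8) is not formalised beyond the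
tree's nearest-neighbour `hamiltonian G t 0`.

References: Lieb–Loss–McCann 1993 [LiebLossMccann1993]; M. Gaudin, Nucl. Phys. 15 (1960) 89
[Gaudin1960] (thermal Wick theorem).
-/

noncomputable section

namespace Literature.MathematicalPhysics.QuantumLattice

open Matrix Finset HubbardWave0
open scoped ComplexOrder

variable {Λ : Type*} [LinearOrder Λ] [Fintype Λ] (G : SimpleGraph Λ) [DecidableRel G.Adj]

/-- The free Hubbard Hamiltonian at zero chemical potential is the second quantisation of its
one-body matrix, in the form used by the uniform density theorem (`μ = U/2` with `U = 0`):
`hamiltonianWith G t 0 (0/2) = dΓ(hubbardOneBody G t 0)`. [cite: LiebLossMccann1993, eq. (2) and Remark I ("This Hamiltonian is quadratic … a one-body operator")] -/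
theorem hamiltonianWith_zero_half_eq_dGamma (t : ℝ) :
    hamiltonianWith G t 0 (0 / 2) = dGamma (hubbardOneBody G t 0) := by
  rw [zero_div, hamiltonianWith_zero_eq_dGamma]

/-- **Uniform density theorem for free electrons, orbital form**: at `U = 0`, `μ = 0`,
`⟨c†_p c_q⟩_β = ½ δ_{pq}` for spin-orbitals `p, q` on sites of the same sign.
[cite: LiebLossMccann1993, Theorem eqs. (5)-(6) ("by specializing to zero interaction", remark before eq. (3))] -/
theorem hubbard_free_gibbsState_creation_mul_annihilation (ε : Λ → ℤˣ)
    (hε : ∀ x y, G.Adj x y → ε x = -ε y) (t β : ℝ) {p q : Orb Λ}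
    (hpq : ε (ofLex p).1 = ε (ofLex q).1) :
    gibbsState β (dGamma (hubbardOneBody G t 0)) (creation p * annihilation q) =
      if p = q then (1 / 2 : ℂ) else 0 := by
  rw [← hamiltonianWith_zero_half_eq_dGamma]
  exact hubbard_gibbsState_creation_mul_annihilation_halfFilling G ε hε t 0 β
    (x := (ofLex p).1) (y := (ofLex q).1) hpq (ofLex p).2 (ofLex q).2

/-- **LLM Remark I, the `n`-point function (Wick + uniform density).** For the free Hubbard model
(`U = 0`) at `μ = 0` on a finite graph with a bipartite sign `ε`, every real `t`, `β`, and
spin-orbitals `(xᵢ, σᵢ)`, `(yⱼ, τⱼ)` ALL on sites of one sign class (`ε xᵢ = ε yⱼ` for all `i, j`):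
`⟨c†_{x₀σ₀} ⋯ c†_{x_{n-1}σ_{n-1}} c_{y_{n-1}τ_{n-1}} ⋯ c_{y₀τ₀}⟩_β = (1/2)^n · det [δ_{(xᵢ,σᵢ),(yⱼ,τⱼ)}]`
("`ρ^{(n)} = 2^{-n} det[δ]`": no correlations within a sublattice save the Pauli principle).
[cite: LiebLossMccann1993, Remark I (display after eq. (10); spin-dependent form after eq. (8))] -/
theorem hubbard_free_gibbsState_nestedWord_sameSublattice (ε : Λ → ℤˣ)
    (hε : ∀ x y, G.Adj x y → ε x = -ε y) (t β : ℝ) (n : ℕ) (p q : Fin n → Orb Λ)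
    (hpq : ∀ k l, ε (ofLex (p k)).1 = ε (ofLex (q l)).1) :
    gibbsState β (hamiltonianWith G t 0 0) (wordOp (nestedWord n p q)) =
      (1 / 2 : ℂ) ^ n * (Matrix.of fun k l => if p k = q l then (1 : ℂ) else 0).det := by
  rw [hamiltonianWith_zero_eq_dGamma,
    gibbsState_dGamma_nestedWord (isHermitian_hubbardOneBody G t 0) β n p q]
  have hM : (Matrix.of fun k l =>
      gibbsState β (dGamma (hubbardOneBody G t 0)) (creation (p k) * annihilation (q l))) =
      (1 / 2 : ℂ) • (Matrix.of fun k l => if p k = q l then (1 : ℂ) else 0) := by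
    ext k l
    rw [Matrix.of_apply, Matrix.smul_apply, Matrix.of_apply,
      hubbard_free_gibbsState_creation_mul_annihilation G ε hε t β (hpq k l), smul_eq_mul, mul_ite,
      mul_one, mul_zero]
  rw [hM, Matrix.det_smul, Fintype.card_fin]

/-- **LLM Remark I, pair density: `ρ^{(2)}_β(x, y; x, y) = 1/4` on a sublattice.** For the free
Hubbard model at `μ = 0` and DISTINCT spin-orbitals `(x, σ) ≠ (y, τ)` on sites of the same sign,
`⟨n_{xσ} n_{yτ}⟩_β = 1/4` at every `β` ("the probability of finding them both occupied … must be
`1/4` at any temperature"). Wick (`HartreeFock.gibbsState_numberAt_mul_numberAt`: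
`⟨n_a n_b⟩ = ⟨n_a⟩⟨n_b⟩ - ⟨c†_a c_b⟩⟨c†_b c_a⟩`) and the uniform density theorem
(`⟨n⟩ = ½`, `⟨c†_a c_b⟩ = 0`). [cite: LiebLossMccann1993, Remark I ("ρ^{(2)}_{βσ}(x,y;x,y) = (1-δ_{xy})/4")] -/
theorem hubbard_free_gibbsState_numberOp_mul_numberOp_sameSublattice (ε : Λ → ℤˣ)
    (hε : ∀ x y, G.Adj x y → ε x = -ε y) (t β : ℝ) {x y : Λ} (hxy : ε x = ε y) {σ τ : Fin 2}
    (hne : orb x σ ≠ orb y τ) :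
    gibbsState β (hamiltonianWith G t 0 0) (numberOp x σ * numberOp y τ) = 1 / 4 := by
  rw [hamiltonianWith_zero_eq_dGamma, ← numberAt_orb, ← numberAt_orb,
    HartreeFock.gibbsState_numberAt_mul_numberAt (isHermitian_hubbardOneBody G t 0) β hne,
    hubbard_free_gibbsState_creation_mul_annihilation G ε hε t β (p := orb x σ) (q := orb x σ) rfl,
    hubbard_free_gibbsState_creation_mul_annihilation G ε hε t β (p := orb y τ) (q := orb y τ) rfl,
    hubbard_free_gibbsState_creation_mul_annihilation G ε hε t β (p := orb x σ) (q := orb y τ) hxy,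
    hubbard_free_gibbsState_creation_mul_annihilation G ε hε t β (p := orb y τ) (q := orb x σ)
      hxy.symm, if_pos rfl, if_pos rfl, if_neg hne, if_neg (Ne.symm hne)]
  norm_num

/-- **No density correlations within a sublattice (free electrons).** Under the same hypotheses,
`⟨n_{xσ} n_{yτ}⟩_β = ⟨n_{xσ}⟩_β ⟨n_{yτ}⟩_β`: "the product of the one-particle densities … the
Pauli pressure is not felt between the electrons at these sites".
[cite: LiebLossMccann1993, Remark I] -/
theorem hubbard_free_gibbsState_numberOp_mul_numberOp_eq_mul (ε : Λ → ℤˣ)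
    (hε : ∀ x y, G.Adj x y → ε x = -ε y) (t β : ℝ) {x y : Λ} (hxy : ε x = ε y) {σ τ : Fin 2}
    (hne : orb x σ ≠ orb y τ) :
    gibbsState β (hamiltonianWith G t 0 0) (numberOp x σ * numberOp y τ) =
      gibbsState β (hamiltonianWith G t 0 0) (numberOp x σ) *
        gibbsState β (hamiltonianWith G t 0 0) (numberOp y τ) := by
  have h0 : hamiltonianWith G t 0 0 = hamiltonianWith G t 0 (0 / 2) := by rw [zero_div]
  rw [hubbard_free_gibbsState_numberOp_mul_numberOp_sameSublattice G ε hε t β hxy hne, h0,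
    hubbard_gibbsState_numberOp_halfFilling G ε hε t 0 β x σ,
    hubbard_gibbsState_numberOp_halfFilling G ε hε t 0 β y τ]
  norm_num

end Literature.MathematicalPhysics.QuantumLattice
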